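import Mathlib
import HarnessLib
import Summits.HubbardSuperconductivity.HubbardSuperconductivity.Theorems.KLProgrammeKLRegimeSplitTwoLegPieceFnBounds
import Summits.HubbardSuperconductivity.HubbardSuperconductivity.Theorems.KLProgrammeKLRegimeSplitModelCongr
import Summits.HubbardSuperconductivity.HubbardSuperconductivity.Theorems.KLProgrammeKLRegimeCountertermProfileSymmetry
import Summits.HubbardSuperconductivity.HubbardSuperconductivity.Theorems.KLProgrammeH10TwoPointLimitFrameFermiPoint
import Summits.HubbardSuperconductivity.HubbardSuperconductivity.Theorems.KLProgrammeKLRegimeSplitFermiPointSmooth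

/-!
# Route `KLProgramme`, crux K3 — Δ23 / (R-I-min) ASSEMBLY: for an admissible `TrigPolyC4v` frame `K` the de-interpolated pieces
# `klTwoLegPieceFn … K.eval n` are G-extensions of TODAY's local-part increments; they are SYMMETRIC FRAMES, `C^∞` on `Momentum` in the
# KL regime, and their (E3a-Fn) sizes are the explicit volume-free bound applied to the ANGULAR data of `ν_{n+1}(K) − ν_n(K)`

Cell gate-hubbard-kl, seat hubbard-kl-k3c3-p1 (g2; row «δμ-flow with `klAngularMean` constant piece»).  Under (R-I-min) (plan g11 Δ23 (H); p2 g6's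
`…SplitFrameFnMin`: frames stay `K : TrigPolyC4v`, the two-leg PIECES become functions, the Fn clause texts are quoted at `K.eval`) the
obligations `IsSymmetricFrame (klTwoLegPieceFn … K.eval n)`, `ContDiff ℝ 4 (onM (klTwoLegPieceFn … K.eval n))` and the tier-1/tier-2 sizes of
`TwoLegSizesFn … K.eval n` meet TODAY's profile facts through p2's model congruence (`klTwoLegPolyFn_eval`, `klFermiPointFn_eval`:
`…SplitModelCongr`).  This file assembles them:

* §1 `klTwoLegPieceFn_eval_succ` / `klTwoLegPieceFn_eval_zero`: `ℓ_{n+1}(K.eval) = klFrameExtFn μ (ν_{n+1}(K) − ν_n(K))`,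
  `ℓ_0(K.eval) = klFrameExtFn μ (ν_0(K) − K∘k_F^K)` with today's `klLocalPart`, `klFermiPoint`;
* §2 **`isSymmetricFrame_klTwoLegPieceFn_eval_succ` / `…_zero`**: the pieces are symmetric frames for `μ ∈ klWindowC` (k3c3-p3's
  `klLocalPart_periodic/_neg/_pi_div_two_sub`, `frameOnCurve_*`), given continuity of the profiles;
* §3 **`norm_iteratedFDeriv_onM_klTwoLegPieceFn_eval_succ_le`**: `‖Dʲ onM (klTwoLegPieceFn L M β U μ K.eval (n+1)) q‖ ≤ [j=0]·|mean δ| +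
  (j!)²·(2·j!·X·200ʲ)·G·(4 + max 1 (5(j−1)!/8))ʲ` at every `q`, from `‖Dⁱ(δ − mean δ)‖ ≤ G` (`i ≤ j`), `δ = ν_{n+1}(K) − ν_n(K)` (`C^N`);
* §4 **`twoLegPieceFn_eval_smooth_symmetric_of_frameOK`** (regime form, thresholds `c₃, U₀` of p1b's `contDiff_klLocalPart_of_frameOK`): for
  EVERY admissible frame (`FrameOK R U (nScales β) ν K`), every volume and scale, the piece at `K.eval` is a symmetric frame and `C^m` on
  `Momentum` for every `m : ℕ∞` — the symmetry / `ContDiff` conjuncts of the (R-I-min) two-leg slot are GENERIC.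

What is left to the ENGINE at each scale is the angular size `G_{n,j}` of the mean-free increment (and `|mean δ|` at `j = 0` — the δμ-flow).
Proofs only; nothing is asserted about the model.
-/

noncomputable section

namespace Summit.HubbardSuperconductivity.HubbardSuperconductivity.Theorems.KLRegimeSplit

set_option linter.dupNamespace false -- summit = problem name (single-conjunct summit), D-0017

open Real Finset Filter MeasureTheory Literature.MathematicalPhysics.QuantumLattice Literature.MathematicalPhysics.QuantumLattice.FermiRG
open Summit.HubbardSuperconductivity.HubbardSuperconductivity.Theorems.PerturbedFermiCurve
open scoped Topology

section Eval

variable {L M : ℕ} [NeZero L] [NeZero M]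

/-! ## §1 The pieces at `K.eval` are G-extensions of today's profile increments -/

/-- **`ℓ_{n+1}(K.eval) = klFrameExtFn μ (ν_{n+1}(K) − ν_n(K))`** with today's local parts `klLocalPart` (continuity of the two profiles for
the integrability of the means). -/
theorem klTwoLegPieceFn_eval_succ (β U μ : ℝ) (K : TrigPolyC4v) (n : ℕ) (h₁ : Continuous (klLocalPart L M β U μ K (n + 1)))
    (h₀ : Continuous (klLocalPart L M β U μ K n)) :
    klTwoLegPieceFn L M β U μ K.eval (n + 1) =
      klFrameExtFn μ (fun θ => klLocalPart L M β U μ K (n + 1) θ - klLocalPart L M β U μ K n θ) := by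
  rw [klTwoLegPieceFn_succ, klTwoLegPolyFn_eval, klTwoLegPolyFn_eval,
    klFrameExtFn_sub_eq μ (h₁.intervalIntegrable _ _) (h₀.intervalIntegrable _ _)]

/-- **`ℓ_0(K.eval) = klFrameExtFn μ (ν_0(K) − K∘k_F^K)`**. -/
theorem klTwoLegPieceFn_eval_zero (β U μ : ℝ) (K : TrigPolyC4v) (h₀ : Continuous (klLocalPart L M β U μ K 0))
    (hK : Continuous fun θ => K.eval (klFermiPoint μ K θ)) :
    klTwoLegPieceFn L M β U μ K.eval 0 =
      klFrameExtFn μ (fun θ => klLocalPart L M β U μ K 0 θ - K.eval (klFermiPoint μ K θ)) := by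
  rw [klTwoLegPieceFn_zero, klTwoLegPolyFn_eval, klFrameProjFn, klFermiPointFn_eval,
    klFrameExtFn_sub_eq μ (h₀.intervalIntegrable _ _) (hK.intervalIntegrable _ _)]

/-! ## §2 Symmetry of the pieces from the `D₄`-symmetries of today's profiles -/

/-- **`ℓ_{n+1}(K.eval)` is a symmetric frame** (`μ ∈ klWindowC`; profiles continuous): the increment `ν_{n+1}(K) − ν_n(K)` is `2π`-periodic,
even and `θ ↦ π/2 − θ` invariant (k3c3-p3's `klLocalPart_periodic/_neg/_pi_div_two_sub`). -/
theorem isSymmetricFrame_klTwoLegPieceFn_eval_succ {β U μ : ℝ} (K : TrigPolyC4v) (n : ℕ)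
    (h₁ : Continuous (klLocalPart L M β U μ K (n + 1))) (h₀ : Continuous (klLocalPart L M β U μ K n)) (hμ : μ ∈ klWindowC) :
    IsSymmetricFrame (klTwoLegPieceFn L M β U μ K.eval (n + 1)) := by
  have hμ' := hμ
  simp only [klWindowC, Set.mem_Icc] at hμ'
  refine isSymmetricFrame_piece (klTwoLegPieceFn_eval_succ β U μ K n h₁ h₀) ?_ ?_ ?_ (by linarith)
  · intro θ
    simp only [klLocalPart_periodic β U μ K (n + 1) θ, klLocalPart_periodic β U μ K n θ]
  · intro θ; rw [klLocalPart_neg, klLocalPart_neg]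
  · intro θ; rw [klLocalPart_pi_div_two_sub, klLocalPart_pi_div_two_sub]

/-- **`ℓ_0(K.eval)` is a symmetric frame.** -/
theorem isSymmetricFrame_klTwoLegPieceFn_eval_zero {β U μ : ℝ} (K : TrigPolyC4v) (h₀ : Continuous (klLocalPart L M β U μ K 0))
    (hK : Continuous fun θ => K.eval (klFermiPoint μ K θ)) (hμ : μ ∈ klWindowC) :
    IsSymmetricFrame (klTwoLegPieceFn L M β U μ K.eval 0) := by
  have hμ' := hμ
  simp only [klWindowC, Set.mem_Icc] at hμ'
  refine isSymmetricFrame_piece (klTwoLegPieceFn_eval_zero β U μ K h₀ hK) ?_ ?_ ?_ (by linarith)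
  · intro θ
    simp only [klLocalPart_periodic β U μ K 0 θ, frameOnCurve_periodic μ K θ]
  · intro θ; rw [klLocalPart_neg, frameOnCurve_neg]
  · intro θ; rw [klLocalPart_pi_div_two_sub, frameOnCurve_pi_div_two_sub]

/-! ## §3 Sizes of the pieces from the angular data of the increments -/

/-- **(E3a-Fn) at `K.eval`, scale `n+1`**: with `δ = ν_{n+1}(K) − ν_n(K)` `C^N` and `‖Dⁱ(δ − mean δ)‖ ≤ G` (`i ≤ j`), `μ ∈ klWindowC`, at every
momentum `‖Dʲ onM (klTwoLegPieceFn L M β U μ K.eval (n+1)) q‖ ≤ [j=0]·|mean δ| + (j!)²·(2·j!·X·200ʲ)·G·(4 + max 1 (5(j−1)!/8))ʲ`. -/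
theorem norm_iteratedFDeriv_onM_klTwoLegPieceFn_eval_succ_le {β U μ : ℝ} (K : TrigPolyC4v) (n : ℕ) {N : WithTop ℕ∞}
    (h₁ : ContDiff ℝ N (klLocalPart L M β U μ K (n + 1))) (h₀ : ContDiff ℝ N (klLocalPart L M β U μ K n))
    {j : ℕ} (hj : (j : WithTop ℕ∞) ≤ N) {G X : ℝ} (hμ : μ ∈ klWindowC)
    (hG : ∀ i ≤ j, ∀ t : ℝ, ‖iteratedFDeriv ℝ i (fun t =>
      (klLocalPart L M β U μ K (n + 1) t - klLocalPart L M β U μ K n t) -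
        klAngularMean (fun θ => klLocalPart L M β U μ K (n + 1) θ - klLocalPart L M β U μ K n θ)) t‖ ≤ G)
    (hX : ∀ l ≤ j, ∀ x : ℝ, ‖iteratedFDeriv ℝ l salmhoferCutoff x‖ ≤ X) (q : Momentum) :
    ‖iteratedFDeriv ℝ j (onM (klTwoLegPieceFn L M β U μ K.eval (n + 1))) q‖ ≤
      (if j = 0 then |klAngularMean (fun θ => klLocalPart L M β U μ K (n + 1) θ - klLocalPart L M β U μ K n θ)| else 0) +
        (j.factorial : ℝ) ^ 2 * (2 * j.factorial * X * 200 ^ j) * G * (4 + max 1 (((j - 1).factorial : ℝ) / (8 / 5))) ^ j :=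
  norm_iteratedFDeriv_onM_piece_le (klTwoLegPieceFn_eval_succ β U μ K n h₁.continuous h₀.continuous) (h₁.sub h₀)
    (fun θ => by simp only [klLocalPart_periodic β U μ K (n + 1) θ, klLocalPart_periodic β U μ K n θ]) hj hμ hG hX q

end Eval

/-! ## §4 In the KL regime: every piece of an admissible `TrigPolyC4v` frame is a SMOOTH SYMMETRIC frame -/

/-- **Regime form**: thresholds `c₃, U₀` (depending on `R` only) such that for admissible data and EVERY frame `K` with
`FrameOK R U (nScales β) ν K`: all de-interpolated pieces `klTwoLegPieceFn L M β U μ K.eval n` are symmetric frames and `C^m` on `Momentum`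
for every `m : ℕ∞` — the `IsSymmetricFrame` / `ContDiff ℝ 4` conjuncts of `FrameOKFn` (for the emitted pieces), `TwoLegSizesFn` and
`TwoLegSizesMSFn` at `K.eval`, discharged generically (from p1b's `contDiff_klLocalPart_of_frameOK` + the symbol-side chain). -/
theorem twoLegPieceFn_eval_smooth_symmetric_of_frameOK (R : RenConsts) (hR : ∀ j, 0 ≤ R.Gfr j) :
    ∃ c₃ : ℝ, 0 < c₃ ∧ ∃ U₀ : ℝ, 0 < U₀ ∧
      ∀ c : ℝ, 0 < c → c ≤ c₃ → ∀ U : ℝ, 0 < U → U ≤ U₀ → ∀ β : ℝ, klBetaMin ≤ β → β ≤ Real.exp (c / U ^ 2) →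
      ∀ μ ∈ klWindowC, ∀ (ν : ℝ) (K : TrigPolyC4v), FrameOK R U (nScales β) ν K →
        ∀ (L M : ℕ) [NeZero L] [NeZero M] (n : ℕ),
          IsSymmetricFrame (klTwoLegPieceFn L M β U μ K.eval n) ∧
            ∀ m : ℕ∞, ContDiff ℝ m (onM (klTwoLegPieceFn L M β U μ K.eval n)) := by
  obtain ⟨c₃, hc₃, U₀, hU₀, H⟩ := contDiff_klLocalPart_of_frameOK R hR
  refine ⟨c₃, hc₃, U₀, hU₀, fun c hc hcc U hU hUU β hβ hβc μ hμ ν K hK L M _ _ n => ?_⟩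
  obtain ⟨hkF, hν⟩ := H c hc hcc U hU hUU β hβ hβc μ hμ ν K hK
  have hνc : ∀ n', Continuous (klLocalPart L M β U μ K n') := fun n' => (hν L M n' 0).continuous
  have hKc : ∀ m : ℕ∞, ContDiff ℝ m fun θ => K.eval (klFermiPoint μ K θ) := fun m =>
    (TrigPolyC4v.contDiff_eval K).comp (hkF m)
  rcases Nat.eq_zero_or_pos n with rfl | _
  · refine ⟨isSymmetricFrame_klTwoLegPieceFn_eval_zero K (hνc 0) (hKc 0).continuous hμ, fun m => ?_⟩
    exact contDiff_onM_piece (klTwoLegPieceFn_eval_zero β U μ K (hνc 0) (hKc 0).continuous) ((hν L M 0 m).sub (hKc m))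
      (fun θ => by simp only [klLocalPart_periodic β U μ K 0 θ, frameOnCurve_periodic μ K θ]) hμ
  · obtain ⟨n, rfl⟩ : ∃ n', n = n' + 1 := ⟨n - 1, by omega⟩
    refine ⟨isSymmetricFrame_klTwoLegPieceFn_eval_succ K n (hνc (n + 1)) (hνc n) hμ, fun m => ?_⟩
    exact contDiff_onM_piece (klTwoLegPieceFn_eval_succ β U μ K n (hνc (n + 1)) (hνc n)) ((hν L M (n + 1) m).sub (hν L M n m))
      (fun θ => by simp only [klLocalPart_periodic β U μ K (n + 1) θ, klLocalPart_periodic β U μ K n θ]) hμ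

end Summit.HubbardSuperconductivity.HubbardSuperconductivity.Theorems.KLRegimeSplit

end
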